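import Literature.MathematicalPhysics.QuantumFieldTheory.WightmanPositivityProofs
import Literature.MathematicalPhysics.QuantumFieldTheory.OSDistributionSpace
import Mathlib.Analysis.InnerProductSpace.Dual
import Mathlib.MeasureTheory.Function.SimpleFuncDense
import HarnessLib

/-!
# Glaser vectors in the OS Hilbert space, I: smeared kernels and their positivity

Support file (everything proved, no named facts) for the discharge of
`Literature.MathematicalPhysics.QuantumFieldTheory.OS1973_cluster` without the analytic
continuation of OS II: the vectors of the OS Hilbert space `ℋ` attached to *smeared mixed points*
of the analytically continued Schwinger functions (V. Glaser, Comm. Math. Phys. 37 (1974), §2: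
the continued Schwinger functions are the Gram kernel `𝕂(P, Q) = ⟪Ψ(P), Ψ(Q)⟫` of vectors
`Ψ(P) ∈ ℋ` attached to the points of the causal domain; Osterwalder–Schrader I (1973), §4.3,
(4.22)–(4.27): the vectors `u(f)`, `w(f)` of the Minkowski test functions).

This first file treats the kernel side:

* `Literature.Analysis.Complex.IsPosSemidefKernelOn.conj_symm`, `….norm_sum_mul_sq_le` —
  Hermitian symmetry and the Cauchy–Schwarz inequality "one point against a finite combination"
  of a positive-semidefinite kernel;
* `sum_integral_integral_kernel_nonneg_of_subset` — the discretisation lemma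
  `∑ᵢⱼ ∫∫ κ conj fᵢ ⊗ fⱼ ≥ 0` of `WightmanPositivityProofs` for kernels that are
  positive-semidefinite and continuous only on open sets carrying the supports;
* `Smearing` — a continuous parametrisation `φ` of mixed points by real configurations together
  with a compactly supported continuous weight `w` (`∫ w(u) Ψ(φ u) du`): Euclidean test functions
  (`Smearing.ofEuclid`), ray-smeared Minkowski test functions (`Smearing.ofRay`);
* `smKernel 𝔚 σ σ' = ∫∫ 𝕂(φ u, φ' u') conj w(u) w'(u') du du'` and its positive-semidefiniteness
  on all smearings (`isPosSemidefKernelOn_smKernel`, from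
  `isPosSemidefKernelOn_osKernel_mixedPts` of `OSPositivityTube`), Hermitian symmetry and the
  Cauchy–Schwarz bound; for Euclidean smearings `smKernel` is the OS pairing
  `𝔖(ΘF* ⊗ G) = ⟪δ_F, δ_G⟫_ℋ` (`smKernel_ofEuclid_ofEuclid`, `schwinger_osPairing_eq_integral`).

## References

* V. Glaser, *On the equivalence of the Euclidean and Wightman formulation of field theory*,
  Comm. Math. Phys. 37 (1974) 257–272, §2. [GlaserCMP1974]
* K. Osterwalder, R. Schrader, *Axioms for Euclidean Green's functions*, Comm. Math. Phys. 31
  (1973) 83–112, §4.1 (4.3), §4.3 (4.22)–(4.27). [OsterwalderSchraderCMP1973]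
-/

noncomputable section

open MeasureTheory Filter Complex ComplexConjugate Metric Set
open scoped Topology ComplexOrder SchwartzMap BigOperators InnerProductSpace

/-! ### Positive-semidefinite kernels: Hermitian symmetry and a Cauchy–Schwarz inequality -/

namespace Literature.Analysis.Complex.IsPosSemidefKernelOn

variable {α : Type*} {K : α → α → ℂ} {A : Set α}

/-- Diagonal values of a positive-semidefinite kernel are real. [folklore] -/
theorem apply_self_im (h : IsPosSemidefKernelOn K A) {x : α} (hx : x ∈ A) : (K x x).im = 0 :=
  (Complex.nonneg_iff.1 (h.apply_self_nonneg hx)).2.symm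

/-- **Hermitian symmetry** of a positive-semidefinite kernel on its set: `conj K(x, y) = K(y, x)`
(test the `2 × 2` principal minor with the coefficient vectors `(1, 1)` and `(1, i)`). [folklore] -/
theorem conj_symm (h : IsPosSemidefKernelOn K A) {x y : α} (hx : x ∈ A) (hy : y ∈ A) :
    conj (K x y) = K y x := by
  have hxx := h.apply_self_im hx
  have hyy := h.apply_self_im hy
  have key : ∀ c : ℂ, (K x x + c * K x y + (conj c * K y x + conj c * c * K y y)).im = 0 := by
    intro c
    have h2 := h 2 ![x, y] (fun i => by fin_cases i <;> simp [hx, hy]) ![1, c]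
    have := (Complex.nonneg_iff.1 h2).2
    simp only [Fin.sum_univ_two, Matrix.cons_val_zero, Matrix.cons_val_one, map_one, one_mul,
      mul_one] at this
    exact this.symm
  have h1 := key 1
  have hI := key I
  simp only [map_one, conj_I, one_mul, neg_mul, Complex.add_im, Complex.neg_im, Complex.mul_im,
    Complex.mul_re, Complex.I_re, Complex.I_im, mul_zero, zero_mul, mul_one,
    zero_sub, add_zero, zero_add, neg_neg] at h1 hI
  apply Complex.ext
  · simp only [Complex.conj_re]
    linarith
  · simp only [Complex.conj_im]
    linarith

/-- The elementary inequality behind Cauchy–Schwarz: if `a‖λ‖² + 2 Re(conj λ · b) + c ≥ 0` for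
all `λ ∈ ℂ`, then `‖b‖² ≤ a c`. [folklore] -/
theorem _root_.Literature.Analysis.Complex.norm_sq_le_mul_of_forall_quadratic_nonneg {a c : ℝ} {b : ℂ}
    (h : ∀ l : ℂ, 0 ≤ a * ‖l‖ ^ 2 + 2 * (conj l * b).re + c) : ‖b‖ ^ 2 ≤ a * c := by
  have hb2 : (conj b * b).re = ‖b‖ ^ 2 := by
    rw [conj_mul', ← ofReal_pow]; exact Complex.ofReal_re _
  -- `λ = -t b`, `t > 0`: `‖b‖² (2t - a t²) ≤ c`
  have ht : ∀ t : ℝ, 0 < t → ‖b‖ ^ 2 * (2 * t - a * t ^ 2) ≤ c := by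
    intro t ht
    have := h (-(t : ℂ) * b)
    have e1 : ‖-(t : ℂ) * b‖ ^ 2 = t ^ 2 * ‖b‖ ^ 2 := by
      rw [norm_mul, norm_neg, Complex.norm_real, Real.norm_eq_abs, abs_of_pos ht]; ring
    have e2 : (conj (-(t : ℂ) * b) * b).re = -t * ‖b‖ ^ 2 := by
      rw [map_mul, map_neg, Complex.conj_ofReal, mul_assoc, neg_mul, Complex.neg_re,
        Complex.re_ofReal_mul, hb2]; ring
    rw [e1, e2] at this
    nlinarith [this]
  have ha : 0 ≤ a := by
    by_contra hneg
    push Not at hneg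
    -- `λ = t` real and large
    have hc : ∀ t : ℝ, 0 < t → 0 ≤ a * t ^ 2 + 2 * t * b.re + c := by
      intro t ht0
      have := h t
      rw [Complex.norm_real, Real.norm_eq_abs, abs_of_pos ht0, Complex.conj_ofReal,
        Complex.re_ofReal_mul] at this
      linarith
    set s : ℝ := 2 * |b.re| + |c| + 1 with hs_def
    have hs1 : 1 ≤ s := by rw [hs_def]; linarith [abs_nonneg b.re, abs_nonneg c]
    have hapos : 0 < -a := by linarith
    set t : ℝ := s / (-a) + 1 with ht_def
    have ht1 : 1 ≤ t := by
      rw [ht_def]; have : 0 ≤ s / (-a) := by positivity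
      linarith
    have ht0 : 0 < t := by linarith
    have hat : a * t ≤ -s := by
      have e : a * (s / -a) = -s := by
        rw [mul_div_assoc', div_eq_iff hapos.ne']; ring
      have : a * t = -s + a := by rw [ht_def, mul_add, e, mul_one]
      linarith
    have h6 : a * t ^ 2 ≤ -s * t := by nlinarith
    have h2 := hc t ht0
    have h7 : 2 * t * b.re ≤ 2 * t * |b.re| := by nlinarith [le_abs_self b.re]
    have h8 : 0 ≤ (t - 1) * |c| := by nlinarith [abs_nonneg c]
    nlinarith [le_abs_self c, abs_nonneg c, abs_nonneg b.re]
  rcases ha.eq_or_lt with ha0 | ha0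
  · -- `a = 0`: then `b = 0`
    rw [← ha0, zero_mul]
    by_contra hpos
    push Not at hpos
    have hb0 : ‖b‖ ≠ 0 := by
      intro h0; rw [h0] at hpos; simp at hpos
    have hc0 : ∀ t : ℝ, 0 < t → ‖b‖ ^ 2 * (2 * t) ≤ c := fun t ht0 => by
      simpa [← ha0] using ht t ht0
    have := hc0 ((|c| + 1) / ‖b‖ ^ 2) (by positivity)
    rw [show ‖b‖ ^ 2 * (2 * ((|c| + 1) / ‖b‖ ^ 2)) = 2 * (|c| + 1) by field_simp] at this
    linarith [le_abs_self c, abs_nonneg c]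
  · have := ht a⁻¹ (inv_pos.2 ha0)
    rw [show 2 * a⁻¹ - a * a⁻¹ ^ 2 = a⁻¹ by field_simp; ring] at this
    rwa [← div_eq_mul_inv, div_le_iff₀ ha0, mul_comm] at this

/-- **Cauchy–Schwarz, one point against a finite combination**: for a positive-semidefinite kernel
on `A`, points `x₀, xᵢ ∈ A` and coefficients `cᵢ`,
`‖∑ᵢ cᵢ K(x₀, xᵢ)‖² ≤ Re K(x₀, x₀) · Re ∑ᵢⱼ conj cᵢ cⱼ K(xᵢ, xⱼ)`. [folklore] -/
theorem norm_sum_mul_sq_le {ι : Type*} [Fintype ι] (h : IsPosSemidefKernelOn K A) {x₀ : α}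
    (hx₀ : x₀ ∈ A) {x : ι → α} (hx : ∀ i, x i ∈ A) (c : ι → ℂ) :
    ‖∑ i, c i * K x₀ (x i)‖ ^ 2 ≤
      (K x₀ x₀).re * (∑ i, ∑ j, conj (c i) * c j * K (x i) (x j)).re := by
  classical
  refine norm_sq_le_mul_of_forall_quadratic_nonneg fun l => ?_
  have hPD := h.sum_nonneg (ι := Option ι) (fun o => o.elim x₀ x)
    (fun o => by cases o <;> simp [hx₀, hx]) (fun o => o.elim l c)
  have hre := (Complex.nonneg_iff.1 hPD).1
  rw [Fintype.sum_option] at hre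
  simp only [Fintype.sum_option, Option.elim_none, Option.elim_some] at hre
  -- identify the real part
  have hsymm : ∀ i, K (x i) x₀ = conj (K x₀ (x i)) := fun i => (h.conj_symm hx₀ (hx i)).symm
  simp only [hsymm] at hre
  have e1 : (conj l * l * K x₀ x₀).re = (K x₀ x₀).re * ‖l‖ ^ 2 := by
    rw [conj_mul', ← ofReal_pow, Complex.re_ofReal_mul]; ring
  have e2 : (∑ i, conj l * c i * K x₀ (x i)).re = (conj l * ∑ i, c i * K x₀ (x i)).re := by
    rw [Finset.mul_sum]; congr 1; refine Finset.sum_congr rfl fun i _ => ?_; ring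
  have e3 : (∑ i, (conj (c i) * l * conj (K x₀ (x i)) +
      ∑ j, conj (c i) * c j * K (x i) (x j))).re =
      (conj l * ∑ i, c i * K x₀ (x i)).re + (∑ i, ∑ j, conj (c i) * c j * K (x i) (x j)).re := by
    rw [Finset.sum_add_distrib, Complex.add_re]
    congr 1
    have : ∑ i, conj (c i) * l * conj (K x₀ (x i)) = conj (conj l * ∑ i, c i * K x₀ (x i)) := by
      rw [map_mul, Complex.conj_conj, map_sum, Finset.mul_sum]
      refine Finset.sum_congr rfl fun i _ => ?_
      rw [map_mul]; ring
    rw [this, Complex.conj_re]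
  rw [Complex.add_re, Complex.add_re, e1, e2, e3] at hre
  linarith

end Literature.Analysis.Complex.IsPosSemidefKernelOn

namespace Literature.MathematicalPhysics.QuantumFieldTheory

open Literature.MathematicalPhysics.QuantumLattice Literature.Analysis.Complex

variable {d : ℕ}

/-! ### Positive-semidefinite kernels continuous on open sets integrate nonnegatively -/

section Discretise

variable {ι : Type} [Fintype ι]

/-- **A positive-semidefinite kernel integrates nonnegatively against `conj f ⊗ f`** — the
discretisation lemma `sum_integral_integral_kernel_nonneg` of `WightmanPositivityProofs` with
positive-semidefiniteness and continuity required only on open sets `Aᵢ` carrying the supports of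
the `fᵢ`: `∑ᵢⱼ ∫∫ κ(⟨i, x⟩, ⟨j, x'⟩) conj fᵢ(x) fⱼ(x') dx dx' ≥ 0`. Same proof (simple-function
discretisation with values in a compact subset of `Aᵢ`, positivity of the finite sums, dominated
convergence). [folklore] -/
theorem sum_integral_integral_kernel_nonneg_of_subset (m : ι → ℕ)
    (κ : (Σ i, (Fin (m i) → SpaceTime d)) → (Σ i, (Fin (m i) → SpaceTime d)) → ℂ)
    (A : (i : ι) → Set (Fin (m i) → SpaceTime d)) (hAo : ∀ i, IsOpen (A i))
    (hAne : ∀ i, (A i).Nonempty)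
    (hκ : IsPosSemidefKernelOn κ {u | u.2 ∈ A u.1})
    (hκc : ∀ i j, ContinuousOn (fun zz : (Fin (m i) → SpaceTime d) × (Fin (m j) → SpaceTime d) =>
      κ ⟨i, zz.1⟩ ⟨j, zz.2⟩) (A i ×ˢ A j))
    (f : (i : ι) → (Fin (m i) → SpaceTime d) → ℂ) (hfc : ∀ i, Continuous (f i))
    (hfK : ∀ i, HasCompactSupport (f i)) (hfA : ∀ i, tsupport (f i) ⊆ A i) :
    0 ≤ ∑ i, ∑ j, ∫ x, ∫ x', κ ⟨i, x⟩ ⟨j, x'⟩ * (conj (f i x) * f j x') := by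
  classical
  -- compact subsets of `A i` carrying the supports, with base points
  choose a ha using hAne
  set K : (i : ι) → Set (Fin (m i) → SpaceTime d) := fun i => tsupport (f i) ∪ {a i} with hK
  have hKc : ∀ i, IsCompact (K i) := fun i => (hfK i).isCompact.union isCompact_singleton
  have hKA : ∀ i, K i ⊆ A i := fun i => union_subset (hfA i) (singleton_subset_iff.2 (ha i))
  have h0K : ∀ i, a i ∈ K i := fun i => Or.inr rfl
  have hKcl : ∀ i, IsClosed (K i) := fun i => (hKc i).isClosed
  -- the discretisations `r i N → id` on `K i`
  set r : (i : ι) → ℕ → SimpleFunc (Fin (m i) → SpaceTime d) (Fin (m i) → SpaceTime d) :=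
    fun i N => SimpleFunc.approxOn id measurable_id (K i) (a i) (h0K i) N with hr
  have hr_mem : ∀ i N x, r i N x ∈ K i := fun i N x =>
    SimpleFunc.approxOn_mem measurable_id (h0K i) N x
  have hr_lim : ∀ i, ∀ x ∈ K i, Tendsto (fun N => r i N x) atTop (𝓝 x) := fun i x hx =>
    SimpleFunc.tendsto_approxOn measurable_id (h0K i) (by rw [(hKcl i).closure_eq]; exact hx)
  -- the pair integrands
  set g : (i j : ι) → (Fin (m i) → SpaceTime d) × (Fin (m j) → SpaceTime d) → ℂ :=
    fun i j zz => κ ⟨i, zz.1⟩ ⟨j, zz.2⟩ * (conj (f i zz.1) * f j zz.2) with hg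
  have hg_zero' : ∀ i j zz, zz ∉ tsupport (f i) ×ˢ tsupport (f j) → g i j zz = 0 := by
    intro i j zz hzz
    rw [Set.mem_prod, not_and_or] at hzz
    rcases hzz with h | h
    · simp [hg, image_eq_zero_of_notMem_tsupport h]
    · simp [hg, image_eq_zero_of_notMem_tsupport h]
  have hg_zero : ∀ i j zz, zz ∉ K i ×ˢ K j → g i j zz = 0 := fun i j zz hzz =>
    hg_zero' i j zz fun h => hzz ⟨Or.inl h.1, Or.inl h.2⟩
  have hgc : ∀ i j, Continuous (g i j) := by
    intro i j
    rw [continuous_iff_continuousAt]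
    intro zz
    by_cases hzz : zz ∈ A i ×ˢ A j
    · have hκat : ContinuousAt (fun zz : (Fin (m i) → SpaceTime d) × (Fin (m j) → SpaceTime d) =>
          κ ⟨i, zz.1⟩ ⟨j, zz.2⟩) zz :=
        (hκc i j).continuousAt (((hAo i).prod (hAo j)).mem_nhds hzz)
      exact hκat.mul (((continuous_conj.comp ((hfc i).comp continuous_fst)).mul
        ((hfc j).comp continuous_snd)).continuousAt)
    · -- `g` vanishes near `zz`
      have hev : g i j =ᶠ[𝓝 zz] fun _ => 0 := by
        rw [Set.mem_prod, not_and_or] at hzz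
        rcases hzz with h | h
        · have h1 : zz.1 ∉ tsupport (f i) := fun h' => h (hfA i h')
          have hev1 := (notMem_tsupport_iff_eventuallyEq.1 h1)
          have : ∀ᶠ ww in 𝓝 zz, f i ww.1 = 0 :=
            (continuousAt_fst (p := zz)).eventually hev1
          filter_upwards [this] with ww hww
          simp [hg, hww]
        · have h1 : zz.2 ∉ tsupport (f j) := fun h' => h (hfA j h')
          have hev1 := (notMem_tsupport_iff_eventuallyEq.1 h1)
          have : ∀ᶠ ww in 𝓝 zz, f j ww.2 = 0 :=
            (continuousAt_snd (p := zz)).eventually hev1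
          filter_upwards [this] with ww hww
          simp [hg, hww]
      exact (continuousAt_const.congr (f := fun _ => (0 : ℂ)) hev.symm)
  have hgK : ∀ i j, HasCompactSupport (g i j) := fun i j =>
    HasCompactSupport.intro' ((hKc i).prod (hKc j)) ((hKcl i).prod (hKcl j)) (hg_zero i j)
  have hgi : ∀ i j, Integrable (g i j) (volume.prod volume) := fun i j =>
    (hgc i j).integrable_of_hasCompactSupport (hgK i j)
  have hiter : ∀ i j, ∫ x, ∫ x', κ ⟨i, x⟩ ⟨j, x'⟩ * (conj (f i x) * f j x') =
      ∫ zz, g i j zz ∂(volume.prod volume) := fun i j => (integral_prod (g i j) (hgi i j)).symm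
  simp_rw [hiter]
  -- fibres, weights, discretised integrands
  set E : (i : ι) → ℕ → (Fin (m i) → SpaceTime d) → Set (Fin (m i) → SpaceTime d) :=
    fun i N b => K i ∩ (r i N) ⁻¹' {b} with hE
  have hEm : ∀ i N b, MeasurableSet (E i N b) := fun i N b =>
    (hKcl i).measurableSet.inter ((r i N).measurableSet_fiber b)
  have hEfin : ∀ i N b, volume (E i N b) < ⊤ := fun i N b =>
    (measure_mono Set.inter_subset_left).trans_lt (hKc i).measure_lt_top
  set w : (i : ι) → ℕ → (Fin (m i) → SpaceTime d) → ℝ :=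
    fun i N b => (volume (E i N b)).toReal with hw
  set H : (i j : ι) → ℕ → (Fin (m i) → SpaceTime d) × (Fin (m j) → SpaceTime d) → ℂ :=
    fun i j N zz => ∑ b ∈ (r i N).range, ∑ b' ∈ (r j N).range,
      (E i N b).indicator (fun _ => (1 : ℂ)) zz.1 * (E j N b').indicator (fun _ => (1 : ℂ)) zz.2 *
        g i j (b, b') with hH
  -- `H = 1_{K×K} · g ∘ (r × r)`
  have hH_eq : ∀ i j N zz, H i j N zz =
      (K i ×ˢ K j).indicator (fun zz => g i j (r i N zz.1, r j N zz.2)) zz := by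
    intro i j N zz
    simp only [hH]
    have hinner : ∀ b, ∑ b' ∈ (r j N).range, (E i N b).indicator (fun _ => (1 : ℂ)) zz.1 *
        (E j N b').indicator (fun _ => (1 : ℂ)) zz.2 * g i j (b, b') =
        (E i N b).indicator (fun _ => (1 : ℂ)) zz.1 *
          (K j).indicator (fun z' => g i j (b, r j N z')) zz.2 := by
      intro b
      rw [← sum_indicator_fiber_mul (r j N) (K j) (fun b' => g i j (b, b')) zz.2, Finset.mul_sum]
      refine Finset.sum_congr rfl fun b' _ => ?_
      ring
    simp_rw [hinner]
    rw [sum_indicator_fiber_mul (r i N) (K i)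
      (fun b => (K j).indicator (fun z' => g i j (b, r j N z')) zz.2) zz.1]
    by_cases h1 : zz.1 ∈ K i
    · by_cases h2 : zz.2 ∈ K j
      · rw [Set.indicator_of_mem h1, Set.indicator_of_mem h2,
          Set.indicator_of_mem (Set.mk_mem_prod h1 h2 : (zz.1, zz.2) ∈ K i ×ˢ K j)]
      · rw [Set.indicator_of_mem h1, Set.indicator_of_notMem h2,
          Set.indicator_of_notMem (fun h : zz ∈ K i ×ˢ K j => h2 h.2)]
    · rw [Set.indicator_of_notMem h1,
        Set.indicator_of_notMem (fun h : zz ∈ K i ×ˢ K j => h1 h.1)]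
  -- integrals of the discretised integrands
  have hterm : ∀ i j N b b', Integrable (fun zz : (Fin (m i) → SpaceTime d) × (Fin (m j) → SpaceTime d) =>
        (E i N b).indicator (fun _ => (1 : ℂ)) zz.1 * (E j N b').indicator (fun _ => (1 : ℂ)) zz.2 *
          g i j (b, b')) (volume.prod volume) ∧
      ∫ zz, (E i N b).indicator (fun _ => (1 : ℂ)) zz.1 * (E j N b').indicator (fun _ => (1 : ℂ)) zz.2 *
          g i j (b, b') ∂(volume.prod volume) = g i j (b, b') * (w i N b * w j N b') := by
    intro i j N b b'
    have hAB : MeasurableSet (E i N b ×ˢ E j N b') := (hEm i N b).prod (hEm j N b')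
    have hvol : (volume.prod volume) (E i N b ×ˢ E j N b') = volume (E i N b) * volume (E j N b') :=
      Measure.prod_prod _ _
    have hfin : (volume.prod volume) (E i N b ×ˢ E j N b') < ⊤ := by
      rw [hvol]; exact ENNReal.mul_lt_top (hEfin i N b) (hEfin j N b')
    have hind : Integrable ((E i N b ×ˢ E j N b').indicator fun _ => (1 : ℂ)) (volume.prod volume) :=
      (integrable_indicator_iff hAB).2 (integrableOn_const hfin.ne)
    simp_rw [indicator_mul_indicator_eq_prod (E i N b) (E j N b')]
    refine ⟨hind.mul_const _, ?_⟩
    rw [integral_mul_const, integral_indicator_const _ hAB, measureReal_def, hvol, ENNReal.toReal_mul]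
    simp only [hw, real_smul, ofReal_mul, mul_one]
    ring
  have hH_int : ∀ i j N, ∫ zz, H i j N zz ∂(volume.prod volume) =
      ∑ b ∈ (r i N).range, ∑ b' ∈ (r j N).range, g i j (b, b') * (w i N b * w j N b') := by
    intro i j N
    simp only [hH]
    rw [integral_finsetSum _ (fun b _ => integrable_finsetSum _ fun b' _ => (hterm i j N b b').1)]
    refine Finset.sum_congr rfl fun b _ => ?_
    rw [integral_finsetSum _ (fun b' _ => (hterm i j N b b').1)]
    exact Finset.sum_congr rfl fun b' _ => (hterm i j N b b').2
  -- positivity of the discretised sums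
  have hrange : ∀ i N, ∀ b ∈ (r i N).range, b ∈ A i := by
    intro i N b hb
    obtain ⟨x, rfl⟩ := (SimpleFunc.mem_range.1 hb)
    exact hKA i (hr_mem i N x)
  have hpos : ∀ N, 0 ≤ ∑ i, ∑ j, ∫ zz, H i j N zz ∂(volume.prod volume) := by
    intro N
    rw [show (∑ i, ∑ j, ∫ zz, H i j N zz ∂(volume.prod volume)) =
        ∑ i, ∑ j, ∑ b ∈ (r i N).range, ∑ b' ∈ (r j N).range, g i j (b, b') * (w i N b * w j N b') from
      Finset.sum_congr rfl fun i _ => Finset.sum_congr rfl fun j _ => hH_int i j N]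
    set S : Finset (Σ i, (Fin (m i) → SpaceTime d)) := Finset.univ.sigma fun i => (r i N).range with hS
    set c : (Σ i, (Fin (m i) → SpaceTime d)) → ℂ := fun u => f u.1 u.2 * (w u.1 N u.2 : ℂ) with hc
    have hmemS : ∀ u : ↥S, ((u : Σ i, (Fin (m i) → SpaceTime d))) ∈
        {u : Σ i, (Fin (m i) → SpaceTime d) | u.2 ∈ A u.1} := by
      intro u
      have hu : (u : Σ i, (Fin (m i) → SpaceTime d)) ∈ Finset.univ.sigma (fun i => (r i N).range) := by
        rw [← hS]; exact u.2
      rw [Finset.mem_sigma] at hu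
      exact hrange _ N _ hu.2
    have hPD := hκ.sum_nonneg (ι := ↥S) (fun u => (u : Σ i, (Fin (m i) → SpaceTime d)))
      hmemS (fun u => c u)
    have hsum : ∑ u : ↥S, ∑ v : ↥S, conj (c u) * c v * κ u v =
        ∑ i, ∑ j, ∑ b ∈ (r i N).range, ∑ b' ∈ (r j N).range, g i j (b, b') * (w i N b * w j N b') := by
      have h2 : ∀ u : Σ i, (Fin (m i) → SpaceTime d),
          ∑ v : ↥S, conj (c u) * c v * κ u v = ∑ v ∈ S, conj (c u) * c v * κ u v :=
        fun u => Finset.sum_coe_sort S (fun v => conj (c u) * c v * κ u v)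
      rw [Finset.sum_coe_sort S (fun u => ∑ v : ↥S, conj (c u) * c v * κ u v)]
      simp_rw [h2]
      rw [hS, Finset.sum_sigma]
      refine Finset.sum_congr rfl fun i _ => ?_
      conv_rhs => rw [Finset.sum_comm]
      refine Finset.sum_congr rfl fun b _ => ?_
      rw [Finset.sum_sigma]
      refine Finset.sum_congr rfl fun j _ => Finset.sum_congr rfl fun b' _ => ?_
      simp only [hc, hg, map_mul, conj_ofReal]
      ring
    rwa [hsum] at hPD
  -- dominated convergence for each pair
  have hlim : ∀ i j, Tendsto (fun N => ∫ zz, H i j N zz ∂(volume.prod volume)) atTop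
      (𝓝 (∫ zz, g i j zz ∂(volume.prod volume))) := by
    intro i j
    obtain ⟨M, hM⟩ := ((hKc i).prod (hKc j)).exists_bound_of_continuousOn (hgc i j).continuousOn
    have hKK : MeasurableSet (K i ×ˢ K j) := (hKcl i).measurableSet.prod (hKcl j).measurableSet
    refine tendsto_integral_of_dominated_convergence
      (fun zz => M * (K i ×ˢ K j).indicator (fun _ => (1 : ℝ)) zz) (fun N => ?_) ?_ (fun N => ?_) ?_
    · have hfun : H i j N = (K i ×ˢ K j).indicator (fun zz => g i j (r i N zz.1, r j N zz.2)) :=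
        funext (hH_eq i j N)
      rw [hfun]
      refine (Measurable.aestronglyMeasurable ?_).indicator hKK
      exact (hgc i j).measurable.comp
        (((r i N).measurable.comp measurable_fst).prodMk ((r j N).measurable.comp measurable_snd))
    · have hfin : (volume.prod volume) (K i ×ˢ K j) < ⊤ := by
        rw [Measure.prod_prod]; exact ENNReal.mul_lt_top (hKc i).measure_lt_top (hKc j).measure_lt_top
      exact ((integrable_indicator_iff hKK).2 (integrableOn_const hfin.ne)).const_mul M
    · refine Eventually.of_forall fun zz => ?_
      rw [hH_eq]
      by_cases hzz : zz ∈ K i ×ˢ K j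
      · rw [Set.indicator_of_mem hzz, Set.indicator_of_mem hzz, mul_one]
        exact hM _ ⟨hr_mem i N zz.1, hr_mem j N zz.2⟩
      · rw [Set.indicator_of_notMem hzz, Set.indicator_of_notMem hzz, norm_zero, mul_zero]
    · refine Eventually.of_forall fun zz => ?_
      simp only [hH_eq]
      by_cases hzz : zz ∈ K i ×ˢ K j
      · simp only [Set.indicator_of_mem hzz]
        have ht : Tendsto (fun N => (r i N zz.1, r j N zz.2)) atTop (𝓝 (zz.1, zz.2)) :=
          (hr_lim i zz.1 hzz.1).prodMk_nhds (hr_lim j zz.2 hzz.2)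
        exact ((hgc i j).tendsto _).comp ht
      · simp only [Set.indicator_of_notMem hzz, hg_zero i j zz hzz]
        exact tendsto_const_nhds
  have hlim_sum : Tendsto (fun N => ∑ i, ∑ j, ∫ zz, H i j N zz ∂(volume.prod volume)) atTop
      (𝓝 (∑ i, ∑ j, ∫ zz, g i j zz ∂(volume.prod volume))) :=
    tendsto_finsetSum _ fun i _ => tendsto_finsetSum _ fun j _ => hlim i j
  exact ge_of_tendsto' hlim_sum hpos

end Discretise

/-! ### The OS kernel is continuous on pairs of mixed points -/

section KernelContinuity

variable {𝔚 : (n : ℕ) → (Fin n → Fin (d + 1) → ℂ) → ℂ}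

/-- For mixed points `z = M(y, τ)`, `w = M(y', τ')` the appended configuration `(revConj z, w)`
lies in the relative forward tube (its imaginary-time profile `(−y⁰_{p-1}, …, −y⁰_0, y'⁰_0, …)` is
strictly increasing). [folklore] -/
theorem append_revConj_mem_relForwardTube_of_mem_mixedPts {p q : ℕ} {z : Fin p → Fin (d + 1) → ℂ}
    {w : Fin q → Fin (d + 1) → ℂ} (hz : (⟨p, z⟩ : Σ n, (Fin n → Fin (d + 1) → ℂ)) ∈ mixedPts d)
    (hw : (⟨q, w⟩ : Σ n, (Fin n → Fin (d + 1) → ℂ)) ∈ mixedPts d) :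
    Fin.append (revConj z) w ∈ relForwardTube d (p + q) := by
  obtain ⟨y, hy, τ, hzeq⟩ := hz
  obtain ⟨y', hy', τ', hweq⟩ := hw
  dsimp only at y hy τ hzeq y' hy' τ' hweq
  subst hzeq; subst hweq
  exact append_revConj_mem_relForwardTube_of_imPart_eq (a := fun k => y k 0) (b := fun k => y' k 0)
    (imPart_mixedPoint y τ) (imPart_mixedPoint y' τ') hy.2 hy.1 hy'.2 hy'.1

/-- **The OS kernel is continuous on pairs of mixed points** (holomorphy of `𝔚ext` on the relative
tube). [folklore] -/
theorem continuousOn_osKernel_mixedPts (h𝔚 : ∀ n, DifferentiableOn ℂ (𝔚 n) (forwardTube d n))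
    (hinv : ∀ n (s : ℝ), 0 ≤ s → ∀ z ∈ forwardTube d n, 𝔚 n (z + iTimeShift d n s) = 𝔚 n z)
    (p q : ℕ) :
    ContinuousOn (fun zz : (Fin p → Fin (d + 1) → ℂ) × (Fin q → Fin (d + 1) → ℂ) =>
        osKernel 𝔚 ⟨p, zz.1⟩ ⟨q, zz.2⟩)
      {zz | (⟨p, zz.1⟩ : Σ n, (Fin n → Fin (d + 1) → ℂ)) ∈ mixedPts d ∧
        (⟨q, zz.2⟩ : Σ n, (Fin n → Fin (d + 1) → ℂ)) ∈ mixedPts d} := by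
  have hmap : Continuous fun zz : (Fin p → Fin (d + 1) → ℂ) × (Fin q → Fin (d + 1) → ℂ) =>
      Fin.append (revConj zz.1) zz.2 :=
    (continuous_fin_append (p := p) (q := q) (α := Fin (d + 1) → ℂ)).comp
      ((continuous_revConj.comp continuous_fst).prodMk continuous_snd)
  refine ((continuousOn_tubeExtension (h𝔚 (p + q)) (hinv (p + q))).comp hmap.continuousOn
    fun zz hzz => ?_).congr fun zz _ => osKernel_apply 𝔚 zz.1 zz.2
  exact append_revConj_mem_relForwardTube_of_mem_mixedPts hzz.1 hzz.2

end KernelContinuity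

/-! ### Smearings of mixed points and the smeared kernel -/

section Smearing

variable (d) in
/-- A **smearing** of degree `m`: a parametrisation `φ` of mixed points of degree `m` by real
configurations `u` ranging in an open set `U`, continuous on `U`, together with a continuous
compactly supported weight `w` supported in `U` — the data of the vector `∫ w(u) Ψ(φ(u)) du`
(Glaser (1974), §2; OS I (1973), (4.26)–(4.27) for the Euclidean case). [folklore] -/
structure Smearing (m : ℕ) where
  /-- The parametrisation by real configurations. -/
  φ : (Fin m → SpaceTime d) → (Fin m → Fin (d + 1) → ℂ)
  /-- The weight. -/
  w : (Fin m → SpaceTime d) → ℂ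
  /-- The parameter domain. -/
  U : Set (Fin m → SpaceTime d)
  isOpen_U : IsOpen U
  nonempty_U : U.Nonempty
  continuousOn_φ : ContinuousOn φ U
  mem_mixedPts : ∀ u ∈ U, (⟨m, φ u⟩ : Σ n, (Fin n → Fin (d + 1) → ℂ)) ∈ mixedPts d
  continuous_w : Continuous w
  hasCompactSupport_w : HasCompactSupport w
  tsupport_subset : tsupport w ⊆ U

variable {m n : ℕ}

namespace Smearing

/-- Scaling the weight of a smearing. [folklore] -/
def scale (c : ℂ) (σ : Smearing d m) : Smearing d m where
  φ := σ.φ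
  w := fun u => c * σ.w u
  U := σ.U
  isOpen_U := σ.isOpen_U
  nonempty_U := σ.nonempty_U
  continuousOn_φ := σ.continuousOn_φ
  mem_mixedPts := σ.mem_mixedPts
  continuous_w := continuous_const.mul σ.continuous_w
  hasCompactSupport_w := σ.hasCompactSupport_w.mul_left
  tsupport_subset := (tsupport_mul_subset_right (f := fun _ => c) (g := σ.w)).trans σ.tsupport_subset

/-- The parametrisation of a scaled smearing. [folklore] -/
@[simp] theorem scale_φ (c : ℂ) (σ : Smearing d m) : (σ.scale c).φ = σ.φ := rfl
/-- The weight of a scaled smearing. [folklore] -/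
@[simp] theorem scale_w (c : ℂ) (σ : Smearing d m) (u : Fin m → SpaceTime d) :
    (σ.scale c).w u = c * σ.w u := rfl

/-- **Euclidean smearings**: a compactly supported time-ordered Euclidean test function `F`,
`φ = ι` (Euclidean points), weight `F` — the vector `v(F) = δ_F` of the OS Hilbert space
(OS I (1973), §4.1). [cite: OsterwalderSchraderCMP1973, §4.1] -/
def ofEuclid (F : 𝓢((Fin n → SpaceTime d), ℂ)) (hF : IsTimeOrdered F)
    (hFc : HasCompactSupport (F : (Fin n → SpaceTime d) → ℂ)) : Smearing d n where
  φ := euclideanPoint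
  w := F
  U := timeOrderedRegion d n
  isOpen_U := isOpen_timeOrderedRegion
  nonempty_U := ⟨rayEuclid 1 0, rayEuclid_mem_timeOrderedRegion one_pos 0⟩
  continuousOn_φ := continuous_euclideanPoint.continuousOn
  mem_mixedPts := fun u hu => ⟨u, hu, 0, (mixedPoint_zero u).symm⟩
  continuous_w := F.continuous
  hasCompactSupport_w := hFc
  tsupport_subset := hF

/-- The parametrisation of a Euclidean smearing. [folklore] -/
@[simp] theorem ofEuclid_φ (F : 𝓢((Fin n → SpaceTime d), ℂ)) (hF : IsTimeOrdered F)
    (hFc : HasCompactSupport (F : (Fin n → SpaceTime d) → ℂ)) : (ofEuclid F hF hFc).φ = euclideanPoint := rfl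
/-- The weight of a Euclidean smearing. [folklore] -/
@[simp] theorem ofEuclid_w (F : 𝓢((Fin n → SpaceTime d), ℂ)) (hF : IsTimeOrdered F)
    (hFc : HasCompactSupport (F : (Fin n → SpaceTime d) → ℂ)) : (ofEuclid F hF hFc).w = F := rfl

/-- Continuity of the ray map `x ↦ x + i s η`. [folklore] -/
theorem _root_.Literature.MathematicalPhysics.QuantumFieldTheory.continuous_rayConfig_left
    (η : Fin m → SpaceTime d) (s : ℝ) : Continuous fun x : Fin m → SpaceTime d => rayConfig η x s :=
  continuous_pi fun k =>
    (continuous_complexifyPoint.comp (continuous_apply k)).add continuous_const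

/-- **Ray smearings**: a compactly supported continuous Minkowski weight `G` smeared along the
ray points `x + i s η`, `η = stdDir` (the regularised vectors `∫ G(x) Ψ(x + isη) dx` whose
`s → 0⁺` limits are the Wightman vectors `u(G)` of OS I (1973), §4.3 (4.27)). [folklore] -/
def ofRay {s : ℝ} (hs : 0 < s) (G : (Fin m → SpaceTime d) → ℂ) (hG : Continuous G)
    (hGc : HasCompactSupport G) : Smearing d m where
  φ := fun x => rayConfig (stdDir d m) x s
  w := G
  U := univ
  isOpen_U := isOpen_univ
  nonempty_U := univ_nonempty
  continuousOn_φ := (continuous_rayConfig_left _ _).continuousOn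
  mem_mixedPts := fun u _ => rayConfig_stdDir_mem_mixedPts hs u
  continuous_w := hG
  hasCompactSupport_w := hGc
  tsupport_subset := subset_univ _

/-- The parametrisation of a ray smearing. [folklore] -/
@[simp] theorem ofRay_φ {s : ℝ} (hs : 0 < s) (G : (Fin m → SpaceTime d) → ℂ) (hG : Continuous G)
    (hGc : HasCompactSupport G) (x : Fin m → SpaceTime d) :
    (ofRay hs G hG hGc).φ x = rayConfig (stdDir d m) x s := rfl
/-- The weight of a ray smearing. [folklore] -/
@[simp] theorem ofRay_w {s : ℝ} (hs : 0 < s) (G : (Fin m → SpaceTime d) → ℂ) (hG : Continuous G)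
    (hGc : HasCompactSupport G) : (ofRay hs G hG hGc).w = G := rfl

end Smearing


variable {𝔚 : (n : ℕ) → (Fin n → Fin (d + 1) → ℂ) → ℂ}

/-- The **smeared OS kernel** of two smearings,
`𝕂(σ, σ') = ∫∫ 𝕂(φ u, φ' u') conj w(u) w'(u') du du'` — the Gram kernel
`⟪∫ w Ψ∘φ, ∫ w' Ψ∘φ'⟫` (Glaser (1974), §2). [cite: GlaserCMP1974, §2] -/
def smKernel (𝔚 : (n : ℕ) → (Fin n → Fin (d + 1) → ℂ) → ℂ) (σ τ : Σ m, Smearing d m) : ℂ :=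
  ∫ u, ∫ u', osKernel 𝔚 ⟨σ.1, σ.2.φ u⟩ ⟨τ.1, τ.2.φ u'⟩ * (conj (σ.2.w u) * τ.2.w u')

/-- Unfolding `smKernel`. [folklore] -/
theorem smKernel_apply (σ : Smearing d m) (τ : Smearing d n) :
    smKernel 𝔚 ⟨m, σ⟩ ⟨n, τ⟩ =
      ∫ u, ∫ u', osKernel 𝔚 ⟨m, σ.φ u⟩ ⟨n, τ.φ u'⟩ * (conj (σ.w u) * τ.w u') := rfl

/-- Scaling the weights scales the smeared kernel sesquilinearly. [folklore] -/
theorem smKernel_scale (c c' : ℂ) (σ : Smearing d m) (τ : Smearing d n) :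
    smKernel 𝔚 ⟨m, σ.scale c⟩ ⟨n, τ.scale c'⟩ = conj c * c' * smKernel 𝔚 ⟨m, σ⟩ ⟨n, τ⟩ := by
  simp only [smKernel_apply, Smearing.scale_φ, Smearing.scale_w, ← integral_const_mul]
  congr 1; funext u; congr 1; funext u'
  simp only [map_mul]; ring

/-- The smeared kernel on the pair of blocks of a finite family, as the double integral of the
discretisation lemma. [folklore] -/
theorem conj_mul_mul_smKernel {ι : Type} (x : ι → Σ m, Smearing d m) (c : ι → ℂ) (i j : ι) :
    conj (c i) * c j * smKernel 𝔚 (x i) (x j) =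
      ∫ u, ∫ u', osKernel 𝔚 ⟨(x i).1, (x i).2.φ u⟩ ⟨(x j).1, (x j).2.φ u'⟩ *
        (conj (c i * (x i).2.w u) * (c j * (x j).2.w u')) := by
  rw [smKernel, ← integral_const_mul]
  congr 1; funext u
  rw [← integral_const_mul]
  congr 1; funext u'
  simp only [map_mul]; ring

/-- **The smeared kernel is positive-semidefinite on all smearings** (from the
positive-semidefiniteness of the OS kernel on mixed points, `OSPositivityTube`, by the
discretisation lemma). [cite: GlaserCMP1974, §2] -/
theorem isPosSemidefKernelOn_smKernel (hPD : IsPosSemidefKernelOn (osKernel 𝔚) (mixedPts d))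
    (hcont : ∀ p q, ContinuousOn (fun zz : (Fin p → Fin (d + 1) → ℂ) × (Fin q → Fin (d + 1) → ℂ) =>
        osKernel 𝔚 ⟨p, zz.1⟩ ⟨q, zz.2⟩)
      {zz | (⟨p, zz.1⟩ : Σ n, (Fin n → Fin (d + 1) → ℂ)) ∈ mixedPts d ∧
        (⟨q, zz.2⟩ : Σ n, (Fin n → Fin (d + 1) → ℂ)) ∈ mixedPts d}) :
    IsPosSemidefKernelOn (smKernel 𝔚) (univ : Set (Σ m, Smearing d m)) := by
  intro k x _ c
  simp_rw [conj_mul_mul_smKernel x c]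
  refine sum_integral_integral_kernel_nonneg_of_subset (fun i => (x i).1)
    (fun u v => osKernel 𝔚 ⟨(x u.1).1, (x u.1).2.φ u.2⟩ ⟨(x v.1).1, (x v.1).2.φ v.2⟩)
    (fun i => (x i).2.U) (fun i => (x i).2.isOpen_U) (fun i => (x i).2.nonempty_U) ?_ ?_
    (fun i u => c i * (x i).2.w u) (fun i => continuous_const.mul (x i).2.continuous_w)
    (fun i => (x i).2.hasCompactSupport_w.mul_left)
    (fun i => (tsupport_mul_subset_right (f := fun _ => c i) (g := (x i).2.w)).trans (x i).2.tsupport_subset)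
  · exact hPD.comp (fun u : Σ i : Fin k, (Fin (x i).1 → SpaceTime d) =>
      (⟨(x u.1).1, (x u.1).2.φ u.2⟩ : Σ n, (Fin n → Fin (d + 1) → ℂ))) fun u hu => (x u.1).2.mem_mixedPts _ hu
  · intro i j
    have hφφ : ContinuousOn (fun zz : (Fin (x i).1 → SpaceTime d) × (Fin (x j).1 → SpaceTime d) =>
        ((x i).2.φ zz.1, (x j).2.φ zz.2)) ((x i).2.U ×ˢ (x j).2.U) :=
      ((x i).2.continuousOn_φ.comp continuousOn_fst fun zz hzz => hzz.1).prodMk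
        ((x j).2.continuousOn_φ.comp continuousOn_snd fun zz hzz => hzz.2)
    exact (hcont _ _).comp hφφ fun zz hzz => ⟨(x i).2.mem_mixedPts _ hzz.1, (x j).2.mem_mixedPts _ hzz.2⟩

/-- **Hermitian symmetry of the smeared kernel.** [folklore] -/
theorem conj_smKernel (hPD : IsPosSemidefKernelOn (smKernel 𝔚) (univ : Set (Σ m, Smearing d m)))
    (σ τ : Σ m, Smearing d m) : conj (smKernel 𝔚 σ τ) = smKernel 𝔚 τ σ :=
  hPD.conj_symm (mem_univ _) (mem_univ _)

/-- The diagonal of the smeared kernel is nonnegative. [folklore] -/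
theorem smKernel_self_nonneg (hPD : IsPosSemidefKernelOn (smKernel 𝔚) (univ : Set (Σ m, Smearing d m)))
    (σ : Σ m, Smearing d m) : 0 ≤ smKernel 𝔚 σ σ :=
  hPD.apply_self_nonneg (mem_univ _)

/-- **Cauchy–Schwarz for the smeared kernel**: one smearing against a finite combination. [folklore] -/
theorem norm_sum_mul_smKernel_sq_le (hPD : IsPosSemidefKernelOn (smKernel 𝔚) (univ : Set (Σ m, Smearing d m)))
    {ι : Type*} [Fintype ι] (σ : Σ m, Smearing d m) (x : ι → Σ m, Smearing d m) (c : ι → ℂ) :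
    ‖∑ i, c i * smKernel 𝔚 σ (x i)‖ ^ 2 ≤
      (smKernel 𝔚 σ σ).re * (∑ i, ∑ j, conj (c i) * c j * smKernel 𝔚 (x i) (x j)).re :=
  hPD.norm_sum_mul_sq_le (mem_univ _) (fun _ => mem_univ _) c

/-- **For Euclidean smearings the smeared kernel is the OS pairing** `𝔖_{n+m}(ΘF* ⊗ G)`
(`schwinger_osPairing_eq_integral`: OS I (1973), (4.3) through the continuation (4.12)). [cite: OsterwalderSchraderCMP1973, §4.3 (4.22)–(4.23)] -/
theorem smKernel_ofEuclid_ofEuclid [NeZero d] {S : SchwingerFamily (EuclideanSpace ℝ (Fin (d + 1)))}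
    (hE1 : S.IsEuclideanCovariant) (h𝔚 : DifferentiableOn ℂ (𝔚 (n + m)) (forwardTube d (n + m)))
    (hS : ∀ F : 𝓢((Fin (n + m) → EuclideanSpace ℝ (Fin (d + 1))), ℂ), IsTimeOrdered F →
      S (n + m) F = ∫ x, 𝔚 (n + m) (euclideanPoint x) * F x)
    {F : 𝓢((Fin n → SpaceTime d), ℂ)} (hF : IsTimeOrdered F)
    (hFc : HasCompactSupport (F : (Fin n → SpaceTime d) → ℂ))
    {G : 𝓢((Fin m → SpaceTime d), ℂ)} (hG : IsTimeOrdered G)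
    (hGc : HasCompactSupport (G : (Fin m → SpaceTime d) → ℂ)) :
    smKernel 𝔚 ⟨n, Smearing.ofEuclid F hF hFc⟩ ⟨m, Smearing.ofEuclid G hG hGc⟩ = S.osPairing F G := by
  rw [smKernel_apply, SchwingerFamily.osPairing, schwinger_osPairing_eq_integral hE1 h𝔚 hS hF hFc hG hGc]
  rfl

end Smearing

/-! ### Glaser vectors in the OS Hilbert space -/

section Hilbert

open Literature.MathematicalPhysics.QuantumLattice.SchwingerFamily (OSSpace OSHilbert PosGen genPairing osFormFree)
open Literature.MathematicalPhysics.QuantumLattice.SchwingerFamily.OSSpace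

variable {S : SchwingerFamily (EuclideanSpace ℝ (Fin (d + 1)))} {hE2 : S.IsOSReflectionPositive}
  {𝔚 : (n : ℕ) → (Fin n → Fin (d + 1) → ℂ) → ℂ}

/-- **Nice generators** of the OS pre-Hilbert space: time-ordered test functions with compact
support (those whose vectors `δ_F` are Euclidean smearings, `Smearing.ofEuclid`). [folklore] -/
def IsNiceGen (q : PosGen (d + 1)) : Prop :=
  IsTimeOrdered q.2.1 ∧ HasCompactSupport (q.2.1 : (Fin q.1 → SpaceTime d) → ℂ)

/-- The Euclidean smearing of a nice generator. [folklore] -/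
def Smearing.ofGen (q : PosGen (d + 1)) (hq : IsNiceGen q) : Σ m, Smearing d m :=
  ⟨q.1, Smearing.ofEuclid q.2.1 hq.1 hq.2⟩

/-- For nice generators the smeared kernel is the OS inner product `⟪δ_p, δ_q⟫ = 𝔖(ΘF_p* ⊗ F_q)`. [cite: OsterwalderSchraderCMP1973, §4.1 eq. (4.3)] -/
theorem smKernel_ofGen_ofGen [NeZero d] (hE1 : S.IsEuclideanCovariant)
    (h𝔚 : ∀ n, DifferentiableOn ℂ (𝔚 n) (forwardTube d n))
    (hS : ∀ n (F : 𝓢((Fin n → EuclideanSpace ℝ (Fin (d + 1))), ℂ)), IsTimeOrdered F →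
      S n F = ∫ x, 𝔚 n (euclideanPoint x) * F x)
    (p q : PosGen (d + 1)) (hp : IsNiceGen p) (hq : IsNiceGen q) :
    smKernel 𝔚 (Smearing.ofGen p hp) (Smearing.ofGen q hq) = genPairing S p q :=
  smKernel_ofEuclid_ofEuclid hE1 (h𝔚 _) (hS _) hp.1 hp.2 hq.1 hq.2

open Classical in
variable (𝔚) in
/-- The values `q ↦ 𝕂(σ, δ_q)` of the functional `⟪b_σ, ·⟫` on nice generators (and `0` on the
other generators). [folklore] -/
def niceCoeff (σ : Σ m, Smearing d m) (q : PosGen (d + 1)) : ℂ :=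
  if h : IsNiceGen q then smKernel 𝔚 σ (Smearing.ofGen q h) else 0

/-- `niceCoeff` on a nice generator. [folklore] -/
theorem niceCoeff_of_isNiceGen (σ : Σ m, Smearing d m) {q : PosGen (d + 1)} (hq : IsNiceGen q) :
    niceCoeff 𝔚 σ q = smKernel 𝔚 σ (Smearing.ofGen q hq) := by
  rw [niceCoeff, dif_pos hq]

variable (S hE2) in
/-- The linear functional on the free module `OSSpace` with prescribed values on the generators. [folklore] -/
def genFunctional (R : PosGen (d + 1) → ℂ) : OSSpace S hE2 →ₗ[ℂ] ℂ :=
  (Finsupp.linearCombination ℂ R) ∘ₗ (OSSpace.of S hE2).symm.toLinearMap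

/-- `genFunctional` as a sum over the support. [folklore] -/
theorem genFunctional_apply (R : PosGen (d + 1) → ℂ) (v : OSSpace S hE2) :
    genFunctional S hE2 R v = ∑ q ∈ ((OSSpace.of S hE2).symm v).support, (OSSpace.of S hE2).symm v q * R q := by
  simp [genFunctional, Finsupp.linearCombination_apply, Finsupp.sum]

/-- `genFunctional` on a basis vector. [folklore] -/
@[simp] theorem genFunctional_δ (R : PosGen (d + 1) → ℂ) (q : PosGen (d + 1)) :
    genFunctional S hE2 R (δ S hE2 q) = R q := by
  simp [genFunctional, OSSpace.δ]

variable (S hE2) in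
/-- The submodule of `OSSpace` spanned by the nice generators. [folklore] -/
def niceModule : Submodule ℂ (OSSpace S hE2) :=
  (Finsupp.supported ℂ ℂ {q : PosGen (d + 1) | IsNiceGen q}).comap (OSSpace.of S hE2).symm.toLinearMap

/-- Membership in the nice module. [folklore] -/
theorem mem_niceModule_iff (v : OSSpace S hE2) :
    v ∈ niceModule S hE2 ↔ ↑((OSSpace.of S hE2).symm v).support ⊆ {q : PosGen (d + 1) | IsNiceGen q} := by
  simp [niceModule, Finsupp.mem_supported]

/-- Basis vectors of nice generators lie in the nice module. [folklore] -/
theorem δ_mem_niceModule {q : PosGen (d + 1)} (hq : IsNiceGen q) : δ S hE2 q ∈ niceModule S hE2 := by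
  rw [mem_niceModule_iff]
  intro p hp
  have hp' : p ∈ (Finsupp.single q (1 : ℂ)).support := by simpa [OSSpace.δ] using hp
  have := Finsupp.support_single_subset hp'
  rw [Finset.mem_singleton] at this
  rw [Set.mem_setOf_eq, this]; exact hq

variable (S hE2) in
/-- The closed subspace `ℋ₀ ⊆ ℋ` generated by the vectors of the nice generators. [folklore] -/
def niceClosure : Submodule ℂ (OSHilbert S hE2) :=
  ((niceModule S hE2).map (ι S hE2).toLinearMap).topologicalClosure

/-- Vectors of the nice module lie in `ℋ₀`. [folklore] -/
theorem ι_mem_niceClosure {v : OSSpace S hE2} (hv : v ∈ niceModule S hE2) :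
    ι S hE2 v ∈ niceClosure S hE2 :=
  Submodule.le_topologicalClosure _ (Submodule.mem_map_of_mem hv)

/-- Basis vectors of nice generators lie in `ℋ₀`. [folklore] -/
theorem ι_δ_mem_niceClosure {q : PosGen (d + 1)} (hq : IsNiceGen q) :
    ι S hE2 (δ S hE2 q) ∈ niceClosure S hE2 :=
  ι_mem_niceClosure (δ_mem_niceModule hq)

/-- Expansion of a vector of the free module in the basis vectors. [folklore] -/
theorem eq_sum_smul_δ (v : OSSpace S hE2) :
    v = ∑ q ∈ ((OSSpace.of S hE2).symm v).support, (OSSpace.of S hE2).symm v q • δ S hE2 q := by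
  conv_lhs => rw [← OSSpace.of_symm_eq v, ← Finsupp.sum_single ((OSSpace.of S hE2).symm v)]
  rw [Finsupp.sum, map_sum]
  refine Finset.sum_congr rfl fun q _ => ?_
  rw [OSSpace.δ, ← map_smul, Finsupp.smul_single, smul_eq_mul, mul_one]

/-- The inner product `⟪v, v⟫` of a vector of the free module as a double sum over its support. [folklore] -/
theorem inner_self_eq_sum (v : OSSpace S hE2) :
    ⟪v, v⟫_ℂ = ∑ p ∈ ((OSSpace.of S hE2).symm v).support, ∑ q ∈ ((OSSpace.of S hE2).symm v).support,
      conj ((OSSpace.of S hE2).symm v p) * (OSSpace.of S hE2).symm v q * genPairing S p q := by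
  rw [OSSpace.inner_def, SchwingerFamily.osFormFree_eq_sum]

/-- **The Cauchy–Schwarz bound for the functional `v ↦ ∑ v_q 𝕂(σ, δ_q)` on the nice module**:
`‖ℓ_σ(v)‖ ≤ √(Re 𝕂(σ, σ)) ‖v‖`. [folklore] -/
theorem norm_genFunctional_niceCoeff_le (hPD : IsPosSemidefKernelOn (smKernel 𝔚) (univ : Set (Σ m, Smearing d m)))
    (hker : ∀ (p q : PosGen (d + 1)) (hp : IsNiceGen p) (hq : IsNiceGen q),
      smKernel 𝔚 (Smearing.ofGen p hp) (Smearing.ofGen q hq) = genPairing S p q)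
    (σ : Σ m, Smearing d m) {v : OSSpace S hE2} (hv : v ∈ niceModule S hE2) :
    ‖genFunctional S hE2 (niceCoeff 𝔚 σ) v‖ ≤ Real.sqrt (smKernel 𝔚 σ σ).re * ‖v‖ := by
  classical
  rw [mem_niceModule_iff] at hv
  set f := (OSSpace.of S hE2).symm v with hf
  have hnice : ∀ q : ↥f.support, IsNiceGen (q : PosGen (d + 1)) := fun q => hv q.2
  -- the functional and the norm as sums over the support
  have hval : genFunctional S hE2 (niceCoeff 𝔚 σ) v =
      ∑ q : ↥f.support, f q * smKernel 𝔚 σ (Smearing.ofGen q (hnice q)) := by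
    rw [genFunctional_apply, ← hf, ← Finset.sum_coe_sort]
    refine Finset.sum_congr rfl fun q _ => ?_
    rw [niceCoeff_of_isNiceGen σ (hnice q)]
  have hnormC : (∑ p : ↥f.support, ∑ q : ↥f.support,
      conj (f p) * f q * smKernel 𝔚 (Smearing.ofGen p (hnice p)) (Smearing.ofGen q (hnice q))) = ⟪v, v⟫_ℂ := by
    rw [inner_self_eq_sum, ← hf]
    calc (∑ p : ↥f.support, ∑ q : ↥f.support,
          conj (f p) * f q * smKernel 𝔚 (Smearing.ofGen p (hnice p)) (Smearing.ofGen q (hnice q)))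
        = ∑ p : ↥f.support, ∑ q : ↥f.support, conj (f p) * f q * genPairing S p q := by
          refine Fintype.sum_congr _ _ fun p => Fintype.sum_congr _ _ fun q => ?_
          rw [hker _ _ (hnice p) (hnice q)]
      _ = ∑ p : ↥f.support, ∑ q ∈ f.support, conj (f p) * f q * genPairing S p q :=
          Fintype.sum_congr _ _ fun p =>
            Finset.sum_coe_sort f.support (fun q => conj (f p) * f q * genPairing S p q)
      _ = ∑ p ∈ f.support, ∑ q ∈ f.support, conj (f p) * f q * genPairing S p q :=
          Finset.sum_coe_sort f.support (fun p => ∑ q ∈ f.support, conj (f p) * f q * genPairing S p q)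
  have hnorm : ‖v‖ ^ 2 = (∑ p : ↥f.support, ∑ q : ↥f.support,
      conj (f p) * f q * smKernel 𝔚 (Smearing.ofGen p (hnice p)) (Smearing.ofGen q (hnice q))).re := by
    rw [@norm_sq_eq_re_inner ℂ, hnormC]; rfl
  have hCS := norm_sum_mul_smKernel_sq_le hPD σ (fun q : ↥f.support => Smearing.ofGen q (hnice q)) (fun q => f q)
  rw [← hval, ← hnorm] at hCS
  have h0 : 0 ≤ (smKernel 𝔚 σ σ).re := (Complex.nonneg_iff.1 (smKernel_self_nonneg hPD σ)).1
  calc ‖genFunctional S hE2 (niceCoeff 𝔚 σ) v‖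
      = Real.sqrt (‖genFunctional S hE2 (niceCoeff 𝔚 σ) v‖ ^ 2) := by rw [Real.sqrt_sq (norm_nonneg _)]
    _ ≤ Real.sqrt ((smKernel 𝔚 σ σ).re * ‖v‖ ^ 2) := Real.sqrt_le_sqrt hCS
    _ = Real.sqrt (smKernel 𝔚 σ σ).re * ‖v‖ := by
        rw [Real.sqrt_mul h0, Real.sqrt_sq (norm_nonneg _)]

variable (S hE2) in
/-- The isometric embedding of the nice module into `ℋ₀`. [folklore] -/
def niceEmb : niceModule S hE2 →L[ℂ] niceClosure S hE2 :=
  ((ι S hE2).toContinuousLinearMap.comp (niceModule S hE2).subtypeL).codRestrict _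
    fun v => ι_mem_niceClosure v.2

/-- `niceEmb` is `ι` on the nice module. [folklore] -/
@[simp] theorem coe_niceEmb (v : niceModule S hE2) : (niceEmb S hE2 v : OSHilbert S hE2) = ι S hE2 v := rfl

/-- `niceEmb` is isometric. [folklore] -/
theorem norm_niceEmb (v : niceModule S hE2) : ‖niceEmb S hE2 v‖ = ‖v‖ := by
  rw [Submodule.coe_norm, coe_niceEmb, OSSpace.norm_ι, Submodule.coe_norm]

/-- `niceEmb` is uniformly inducing. [folklore] -/
theorem isUniformInducing_niceEmb : IsUniformInducing (niceEmb S hE2) :=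
  (AddMonoidHomClass.isometry_of_norm (niceEmb S hE2) norm_niceEmb).isUniformInducing

/-- `niceEmb` has dense range in `ℋ₀`. [folklore] -/
theorem denseRange_niceEmb : DenseRange (niceEmb S hE2) := by
  rw [DenseRange, Topology.IsInducing.subtypeVal.dense_iff]
  intro x
  have hx : (x : OSHilbert S hE2) ∈ closure (((niceModule S hE2).map (ι S hE2).toLinearMap : Submodule ℂ _) : Set _) := by
    rw [← Submodule.topologicalClosure_coe]; exact x.2
  refine closure_mono ?_ hx
  rintro y ⟨v, hv, rfl⟩
  exact ⟨⟨ι S hE2 v, ι_mem_niceClosure hv⟩, ⟨⟨v, hv⟩, rfl⟩, rfl⟩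

/-- `ℋ₀` is complete (closed in `ℋ`). [folklore] -/
instance : CompleteSpace (niceClosure S hE2) :=
  (Submodule.isClosed_topologicalClosure _).completeSpace_coe

/-- **Glaser vectors.** For every smearing `σ` there is a vector `b_σ ∈ ℋ₀` with
`⟪b_σ, δ_q⟫ = 𝕂(σ, δ_q)` for all nice generators `q` and `‖b_σ‖² ≤ Re 𝕂(σ, σ)` — the vector
`∫ w(u) Ψ(φ u) du` of Glaser (1974), §2 (Riesz representation of the Cauchy–Schwarz-bounded
functional `∑ c_q δ_q ↦ ∑ c_q 𝕂(σ, δ_q)` on the nice module, extended to its closure `ℋ₀`). [cite: GlaserCMP1974, §2] -/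
theorem exists_glaserVec (hPD : IsPosSemidefKernelOn (smKernel 𝔚) (univ : Set (Σ m, Smearing d m)))
    (hker : ∀ (p q : PosGen (d + 1)) (hp : IsNiceGen p) (hq : IsNiceGen q),
      smKernel 𝔚 (Smearing.ofGen p hp) (Smearing.ofGen q hq) = genPairing S p q)
    (σ : Σ m, Smearing d m) :
    ∃ b : OSHilbert S hE2, b ∈ niceClosure S hE2 ∧
      (∀ (q : PosGen (d + 1)) (hq : IsNiceGen q),
        ⟪b, ι S hE2 (δ S hE2 q)⟫_ℂ = smKernel 𝔚 σ (Smearing.ofGen q hq)) ∧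
      ‖b‖ ^ 2 ≤ (smKernel 𝔚 σ σ).re := by
  set C : ℝ := Real.sqrt (smKernel 𝔚 σ σ).re with hC
  have hC0 : 0 ≤ C := Real.sqrt_nonneg _
  -- the bounded functional on the nice module
  set ℓ₀ : niceModule S hE2 →L[ℂ] ℂ :=
    ((genFunctional S hE2 (niceCoeff 𝔚 σ)).domRestrict (niceModule S hE2)).mkContinuous C
      (fun v => by
        rw [LinearMap.domRestrict_apply, Submodule.coe_norm]
        exact norm_genFunctional_niceCoeff_le hPD hker σ v.2) with hℓ₀
  have hℓ₀_apply : ∀ v : niceModule S hE2, ℓ₀ v = genFunctional S hE2 (niceCoeff 𝔚 σ) v := fun v => rfl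
  have hℓ₀_bound : ∀ v : niceModule S hE2, ‖ℓ₀ v‖ ≤ C * ‖v‖ := fun v => by
    rw [hℓ₀_apply, Submodule.coe_norm]
    exact norm_genFunctional_niceCoeff_le hPD hker σ v.2
  -- its extension to `ℋ₀`
  set ℓ : niceClosure S hE2 →L[ℂ] ℂ := ℓ₀.extend (niceEmb S hE2) with hℓ
  have hℓe : ∀ v, ℓ (niceEmb S hE2 v) = ℓ₀ v := fun v =>
    ContinuousLinearMap.extend_eq ℓ₀ denseRange_niceEmb isUniformInducing_niceEmb v
  have hℓ_bound : ∀ x : niceClosure S hE2, ‖ℓ x‖ ≤ C * ‖x‖ := by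
    intro x
    refine denseRange_niceEmb.induction_on x
      (isClosed_le (continuous_norm.comp ℓ.continuous) (continuous_const.mul continuous_norm)) ?_
    intro v
    rw [hℓe, norm_niceEmb]
    exact hℓ₀_bound v
  -- Riesz representation in `ℋ₀`
  set b₀ : niceClosure S hE2 := (InnerProductSpace.toDual ℂ (niceClosure S hE2)).symm ℓ with hb₀
  refine ⟨(b₀ : OSHilbert S hE2), b₀.2, fun q hq => ?_, ?_⟩
  · have hmem := ι_δ_mem_niceClosure (S := S) (hE2 := hE2) hq
    have h1 : ⟪(b₀ : OSHilbert S hE2), ι S hE2 (δ S hE2 q)⟫_ℂ =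
        ⟪b₀, (⟨ι S hE2 (δ S hE2 q), hmem⟩ : niceClosure S hE2)⟫_ℂ := rfl
    rw [h1, hb₀, InnerProductSpace.toDual_symm_apply]
    have h2 : (⟨ι S hE2 (δ S hE2 q), hmem⟩ : niceClosure S hE2) =
        niceEmb S hE2 ⟨δ S hE2 q, δ_mem_niceModule hq⟩ := Subtype.ext rfl
    rw [h2, hℓe, hℓ₀_apply]
    change genFunctional S hE2 (niceCoeff 𝔚 σ) (δ S hE2 q) = _
    rw [genFunctional_δ, niceCoeff_of_isNiceGen σ hq]
  · have hnorm : ‖(b₀ : OSHilbert S hE2)‖ = ‖ℓ‖ := by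
      rw [show ‖(b₀ : OSHilbert S hE2)‖ = ‖b₀‖ from rfl, hb₀, LinearIsometryEquiv.norm_map]
    have hle : ‖(b₀ : OSHilbert S hE2)‖ ≤ C := hnorm ▸ ℓ.opNorm_le_bound hC0 hℓ_bound
    have h0 : 0 ≤ (smKernel 𝔚 σ σ).re := (Complex.nonneg_iff.1 (smKernel_self_nonneg hPD σ)).1
    calc ‖(b₀ : OSHilbert S hE2)‖ ^ 2 ≤ C ^ 2 := pow_le_pow_left₀ (norm_nonneg _) hle 2
      _ = (smKernel 𝔚 σ σ).re := by rw [hC, Real.sq_sqrt h0]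

/-- **Uniqueness in `ℋ₀`**: two vectors of `ℋ₀` with the same inner products against all nice
generators coincide. [folklore] -/
theorem eq_of_forall_inner_ι_δ {x y : OSHilbert S hE2} (hx : x ∈ niceClosure S hE2)
    (hy : y ∈ niceClosure S hE2)
    (h : ∀ q : PosGen (d + 1), IsNiceGen q → ⟪x, ι S hE2 (δ S hE2 q)⟫_ℂ = ⟪y, ι S hE2 (δ S hE2 q)⟫_ℂ) :
    x = y := by
  set K : Submodule ℂ (OSHilbert S hE2) := (niceModule S hE2).map (ι S hE2).toLinearMap with hK
  have hz : x - y ∈ Kᗮ := by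
    rw [Submodule.mem_orthogonal]
    rintro u ⟨v, hv, rfl⟩
    have hv' := (mem_niceModule_iff v).1 hv
    change ⟪ι S hE2 v, x - y⟫_ℂ = 0
    rw [eq_sum_smul_δ v, map_sum, sum_inner]
    refine Finset.sum_eq_zero fun q hq => ?_
    have hq' : IsNiceGen q := hv' (Finset.mem_coe.2 hq)
    have e : ⟪ι S hE2 (δ S hE2 q), x⟫_ℂ = ⟪ι S hE2 (δ S hE2 q), y⟫_ℂ := by
      rw [← inner_conj_symm, h q hq', inner_conj_symm]
    rw [map_smul, inner_smul_left, inner_sub_right, e, sub_self, mul_zero]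
  have hz' : x - y ∈ niceClosure S hE2 := Submodule.sub_mem _ hx hy
  have hbot : x - y ∈ (niceClosure S hE2) ⊓ (niceClosure S hE2)ᗮ := by
    refine ⟨hz', ?_⟩
    rw [niceClosure, Submodule.orthogonal_closure]
    exact hz
  rw [Submodule.inf_orthogonal_eq_bot, Submodule.mem_bot] at hbot
  exact sub_eq_zero.1 hbot

end Hilbert

/-! ### Assembly: the Glaser vectors of an OS continuation -/

section Assembly

open Literature.MathematicalPhysics.QuantumLattice.SchwingerFamily (OSSpace OSHilbert PosGen genPairing)
open Literature.MathematicalPhysics.QuantumLattice.SchwingerFamily.OSSpace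

variable [NeZero d] {S : SchwingerFamily (EuclideanSpace ℝ (Fin (d + 1)))}
  {𝔚 : (n : ℕ) → (Fin n → Fin (d + 1) → ℂ) → ℂ}

variable (S 𝔚) in
/-- The hypotheses on the continuation: E1 for `S`, and `𝔚ₙ` holomorphic on `𝒯ₙ` reproducing `𝔖ₙ`
at Euclidean points (the data of `IsOSContinuationFamily` without the boundary values). [folklore] -/
structure GlaserHyp : Prop where
  covariant : S.IsEuclideanCovariant
  differentiableOn : ∀ n, DifferentiableOn ℂ (𝔚 n) (forwardTube d n)
  schwinger : ∀ n (F : 𝓢((Fin n → EuclideanSpace ℝ (Fin (d + 1))), ℂ)), IsTimeOrdered F →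
    S n F = ∫ x, 𝔚 n (euclideanPoint x) * F x

namespace GlaserHyp

variable (h : GlaserHyp S 𝔚)
include h

omit [NeZero d] in
/-- Invariance of `𝔚ₙ` under imaginary time shifts (E1). [folklore] -/
theorem timeShift (n : ℕ) (s : ℝ) (hs : 0 ≤ s) :
    ∀ z ∈ forwardTube d n, 𝔚 n (z + iTimeShift d n s) = 𝔚 n z :=
  eqOn_forwardTube_add_iTimeShift h.covariant (h.differentiableOn n) (h.schwinger n) s hs

omit [NeZero d] in
/-- Continuity of the OS kernel on mixed pairs. [folklore] -/
theorem continuousOn_osKernel (p q : ℕ) :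
    ContinuousOn (fun zz : (Fin p → Fin (d + 1) → ℂ) × (Fin q → Fin (d + 1) → ℂ) =>
        osKernel 𝔚 ⟨p, zz.1⟩ ⟨q, zz.2⟩)
      {zz | (⟨p, zz.1⟩ : Σ n, (Fin n → Fin (d + 1) → ℂ)) ∈ mixedPts d ∧
        (⟨q, zz.2⟩ : Σ n, (Fin n → Fin (d + 1) → ℂ)) ∈ mixedPts d} :=
  continuousOn_osKernel_mixedPts h.differentiableOn h.timeShift p q

/-- The OS kernel is positive-semidefinite on mixed points (`OSPositivityTube`). [cite: GlaserCMP1974, §2] -/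
theorem osKernel_posSemidef (hE2 : S.IsOSReflectionPositive) : IsPosSemidefKernelOn (osKernel 𝔚) (mixedPts d) :=
  isPosSemidefKernelOn_osKernel_mixedPts h.covariant hE2 𝔚 h.differentiableOn h.schwinger

/-- The smeared kernel is positive-semidefinite on all smearings. [cite: GlaserCMP1974, §2] -/
theorem smKernel_posSemidef (hE2 : S.IsOSReflectionPositive) :
    IsPosSemidefKernelOn (smKernel 𝔚) (univ : Set (Σ m, Smearing d m)) :=
  isPosSemidefKernelOn_smKernel (h.osKernel_posSemidef hE2) h.continuousOn_osKernel

/-- The smeared kernel of nice generators is the OS inner product. [folklore] -/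
theorem smKernel_ofGen (p q : PosGen (d + 1)) (hp : IsNiceGen p) (hq : IsNiceGen q) :
    smKernel 𝔚 (Smearing.ofGen p hp) (Smearing.ofGen q hq) = genPairing S p q :=
  smKernel_ofGen_ofGen h.covariant h.differentiableOn h.schwinger p q hp hq

/-- **The Glaser vector of a smearing** (choice from `exists_glaserVec`). [cite: GlaserCMP1974, §2] -/
def glaserVec (hE2 : S.IsOSReflectionPositive) (σ : Σ m, Smearing d m) : OSHilbert S hE2 :=
  (exists_glaserVec (hE2 := hE2) (h.smKernel_posSemidef hE2) h.smKernel_ofGen σ).choose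

/-- The Glaser vector lies in `ℋ₀`. [folklore] -/
theorem glaserVec_mem (hE2 : S.IsOSReflectionPositive) (σ : Σ m, Smearing d m) :
    h.glaserVec hE2 σ ∈ niceClosure S hE2 :=
  (exists_glaserVec (hE2 := hE2) (h.smKernel_posSemidef hE2) h.smKernel_ofGen σ).choose_spec.1

/-- **`⟪b_σ, δ_q⟫ = 𝕂(σ, δ_q)`** for nice generators `q`. [cite: GlaserCMP1974, §2] -/
theorem inner_glaserVec_ι_δ (hE2 : S.IsOSReflectionPositive) (σ : Σ m, Smearing d m) (q : PosGen (d + 1))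
    (hq : IsNiceGen q) :
    ⟪h.glaserVec hE2 σ, ι S hE2 (δ S hE2 q)⟫_ℂ = smKernel 𝔚 σ (Smearing.ofGen q hq) :=
  (exists_glaserVec (hE2 := hE2) (h.smKernel_posSemidef hE2) h.smKernel_ofGen σ).choose_spec.2.1 q hq

/-- **`‖b_σ‖² ≤ Re 𝕂(σ, σ)`.** [cite: GlaserCMP1974, §2] -/
theorem norm_glaserVec_sq_le (hE2 : S.IsOSReflectionPositive) (σ : Σ m, Smearing d m) :
    ‖h.glaserVec hE2 σ‖ ^ 2 ≤ (smKernel 𝔚 σ σ).re :=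
  (exists_glaserVec (hE2 := hE2) (h.smKernel_posSemidef hE2) h.smKernel_ofGen σ).choose_spec.2.2

/-- Glaser vectors of smearings with the same kernel against all nice generators coincide. [folklore] -/
theorem glaserVec_congr (hE2 : S.IsOSReflectionPositive) {σ τ : Σ m, Smearing d m}
    (hστ : ∀ (q : PosGen (d + 1)) (hq : IsNiceGen q),
      smKernel 𝔚 σ (Smearing.ofGen q hq) = smKernel 𝔚 τ (Smearing.ofGen q hq)) :
    h.glaserVec hE2 σ = h.glaserVec hE2 τ :=
  eq_of_forall_inner_ι_δ (h.glaserVec_mem hE2 σ) (h.glaserVec_mem hE2 τ) fun q hq => by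
    rw [h.inner_glaserVec_ι_δ hE2 σ q hq, h.inner_glaserVec_ι_δ hE2 τ q hq, hστ q hq]

/-- **The Glaser vector of a nice generator is its basis vector** `δ_q`. [folklore] -/
theorem glaserVec_ofGen (hE2 : S.IsOSReflectionPositive) (q : PosGen (d + 1)) (hq : IsNiceGen q) :
    h.glaserVec hE2 (Smearing.ofGen q hq) = ι S hE2 (δ S hE2 q) :=
  eq_of_forall_inner_ι_δ (h.glaserVec_mem hE2 _) (ι_δ_mem_niceClosure hq) fun p hp => by
    rw [h.inner_glaserVec_ι_δ hE2 _ p hp, h.smKernel_ofGen q p hq hp, OSSpace.inner_ι_ι,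
      OSSpace.inner_δ_δ]

end GlaserHyp

omit [NeZero d] in
/-- An OS continuation family provides the Glaser hypotheses (choice of the continuations). [folklore] -/
theorem IsOSContinuationFamily.exists_glaserHyp {𝒲 : Literature.Analysis.FunctionSpaces.WightmanFamily d Unit}
    (hE1 : S.IsEuclideanCovariant) (h𝒲 : IsOSContinuationFamily S 𝒲) :
    ∃ 𝔚 : (n : ℕ) → (Fin n → Fin (d + 1) → ℂ) → ℂ, GlaserHyp S 𝔚 ∧
      ∀ n, HasDistributionalBoundaryValue (𝔚 n) (𝒲 n fun _ => ()) := by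
  choose 𝔚 h𝔚 hbv hS using h𝒲
  exact ⟨𝔚, ⟨hE1, h𝔚, hS⟩, hbv⟩

end Assembly



end Literature.MathematicalPhysics.QuantumFieldTheory
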